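import Mathlib

/-!
# Venture HSemireg — (S5) OBSTRUCTION LOCUS away from secant type, XI: the `H¹(T)`-directions in Mathlib's exterior
# algebra, with Mathlib's signs — (a) the polarised directions `θ_ab + θ_ba` contract every power of the principal
# polarisation `b`, hence all of `K[b]`, to ZERO (the (S2) input of the named hypothesis shape (H-NC)); (b) the
# DICTIONARY LINE of files III / VI: `θ_q ⌟ [B_S]` vanishes unless `q` is active and is then `± dz_{S∖q.2} ∧ dz̄_{S∪q.1}`

HONEST FRAMING.  Part of the Lean side of the computation cell `pub-hsemireg` (track «S4-PUSH» (ii), seat s4-prove-2).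
The hypothesis shape (H-NC) of file I (`ReduciblePointObject.HNC`: «`G`-semiregular ⟹ `ob_F(θ_ab + θ_ba) = 0` on the
invariant edges») rests ON PAPER on two inputs: Buchweitz–Flenner's `σ_F(ob_F(ξ)) = ± ξ ⌟ ch(F)` (BF 2003 §4 / 2008
Prop. 6.4.4) — NOT touched here — and the (S2)-type identity «`ξ ⌟ c = 0` for every polarised direction
`ξ = θ_ab + θ_ba` and every class `c ∈ ℚ[b]`», `b = Σ_k dz_k ∧ dz̄_k` the principal polarisation of `X = E^n`
(G2-DEFORM-SANITY §B.4 / CONJECTURE-G2 (J) v3 (S2)).  This file PROVES the latter as exterior-algebra algebra, for every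
`n`, over any commutative ring, in Mathlib's `ExteriorAlgebra K (W ⊕ W̄)` (`W = ⟨dz_k⟩`, `W̄ = ⟨dz̄_k⟩`) with Mathlib's
own signs (`CliffordAlgebra.contractLeft`, `ExteriorAlgebra.ι_add_mul_swap`) — no sign convention of the cell is used.
Nothing here constructs a variety, a Chern character or `σ`; nothing here says that HC / HC_CM / HC_AV holds; no
Literature fact is declared or used; (H-NC) stays a NAMED binder of file I (its BF half is prose).

DICTIONARY (not asserted in Lean): `⊕ H^{p,q}(E^n) = Λ(W ⊕ W̄)`; `θ_ab = dz̄_a ⊗ ∂_b ∈ H¹(T_X)` acts on forms by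
`ω ↦ dz̄_a ∧ (∂_b ⌟ ω)` (`thetaOp a b`; a global sign convention does not affect vanishing); `ch(F) ∈ ℚ[b]` for the objects
of record ((S2)); hence `(θ_ab + θ_ba) ⌟ ch(F) = 0`.

* `dz`, `dzb`, `del` (`∂_l` as a dual vector: reads the `dz_l`-coordinate, kills `W̄`), `bForm = Σ_k dz_k * dz̄_k`,
  `thetaOp`.
* `contract_bForm_mul` — graded Leibniz through the EVEN element `b`: `∂_l ⌟ (b * x) = dz̄_l * x + b * (∂_l ⌟ x)`.
* `bForm_mul_ι` — `b` is central on generators (even element of the exterior algebra).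
* `contract_bForm_pow` — `∂_l ⌟ b^m = m • dz̄_l * b^(m-1)`.
* **`thetaOp_add_thetaOp_bForm_pow`** — `(θ_ab + θ_ba) ⌟ b^m = 0` for all `a, b, m`;
  **`thetaOp_add_thetaOp_aeval_bForm`** — `(θ_ab + θ_ba) ⌟ P(b) = 0` for every polynomial `P`: the polarised
  directions kill `K[b]`.  (`thetaOp`, not `theta`: file I's `theta k l` is the coefficient MATRIX of `θ_kl`.)
PART (b) (the dictionary of files III `blochTarget` / VI `act`, `tg`, `kappa` / VII, which MODEL `θ_q ⌟ [B_S]` by the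
rule «`±` monomial `(S ∖ q.2, S ∪ q.1)` if `q.1 ∉ S ∋ q.2`, else `0`» with arbitrary non-zero signs): for
`b_S = ∏_{s∈S} dz_s ∧ dz̄_s` (`∼ [B_S]`; a commuting product of even elements, `Finset.noncommProd`):
* `pairForm`, `pairForm_comm`, `bS`, `bS_insert`, `bS_mul_ι`, `contract_pairForm_mul`;
* **`contract_bS`** — `∂_l ⌟ b_S = dz̄_l * b_{S∖l}` if `l ∈ S`, else `0`;
* **`thetaOp_bS`** — `θ_{ik}(b_S) = dz̄_i * dz̄_k * b_{S∖k}` if `k ∈ S`, else `0`; **`thetaOp_bS_eq_zero_of_mem`** — `= 0`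
  whenever `i ∈ S`; **`mem_act_of_thetaOp_bS_ne_zero`** — `θ_{ik}(b_S) ≠ 0 ⟹ i ∉ S ∧ k ∈ S` (= `(i,k) ∈ act S` of file
  VI), and the surviving form `dz̄_i ∧ dz̄_k ∧ ∏_{s∈S∖k} dz_s ∧ dz̄_s` is the signed monomial with `dz`-indices `S ∖ k`,
  `dz̄`-indices `S ∪ {i}` — `tg S (i,k)`.  `[B_S] ∼ dz_S ∧ dz̄_S` itself stays DICTIONARY.
References (dictionary only): G2-DEFORM-SANITY.md §B.4–B.5, §C.1; CONJECTURE-G2 (J) v3 (S2); STRUCTURE.md §2 (S2)/(S5);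
Bloch 1972 §6; files III, VI, VII of this series.
-/

open scoped BigOperators
open CliffordAlgebra

namespace Summit.Ventures.HSemireg.ObstructionLocus

variable (K : Type*) [CommRing K] (n : ℕ)

/-- The `1`-forms of `X = E^n`: `dz`-coordinates and `dz̄`-coordinates (`W ⊕ W̄`). -/
abbrev OneForms : Type _ := (Fin n → K) × (Fin n → K)

/-- All forms: the exterior algebra `Λ(W ⊕ W̄) = ⊕ H^{p,q}`. -/
abbrev Forms : Type _ := ExteriorAlgebra K (OneForms K n)

variable {K n}

/-- `dz_k`. -/
noncomputable def dz (k : Fin n) : Forms K n := ExteriorAlgebra.ι K ((Pi.single k 1, 0) : OneForms K n)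

/-- `dz̄_k`. -/
noncomputable def dzb (k : Fin n) : Forms K n := ExteriorAlgebra.ι K ((0, Pi.single k 1) : OneForms K n)

/-- `∂_l` as a dual vector on `1`-forms: the `dz_l`-coordinate (zero on `W̄`). -/
noncomputable def del (l : Fin n) : Module.Dual K (OneForms K n) :=
  (LinearMap.proj l) ∘ₗ LinearMap.fst K (Fin n → K) (Fin n → K)

/-- `∂_l(dz_k) = δ_{kl}`. -/
theorem del_dz (l k : Fin n) : del l ((Pi.single k 1, 0) : OneForms K n) = if l = k then 1 else 0 := by
  simp [del, Pi.single_apply]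

/-- `∂_l(dz̄_k) = 0`. -/
theorem del_dzb (l k : Fin n) : del l ((0, Pi.single k 1) : OneForms K n) = 0 := by
  simp [del]

/-- The principal polarisation `b = Σ_k dz_k ∧ dz̄_k`. -/
noncomputable def bForm : Forms K n := ∑ k, dz k * dzb k

/-- `θ_ab ⌟ ω = dz̄_a ∧ (∂_b ⌟ ω)`. -/
noncomputable def thetaOp (a b : Fin n) : Forms K n →ₗ[K] Forms K n :=
  (LinearMap.mulLeft K (dzb a)) ∘ₗ (contractLeft (del b))

/-- `thetaOp` unfolded. -/
theorem thetaOp_apply (a b : Fin n) (ω : Forms K n) : thetaOp a b ω = dzb a * contractLeft (del b) ω := rfl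

/-- `∂_l ⌟ (dz_k * x) = δ_{kl} x − dz_k * (∂_l ⌟ x)`. -/
theorem contract_dz_mul (l k : Fin n) (x : Forms K n) :
    contractLeft (del l) (dz k * x) = (if l = k then x else 0) - dz k * contractLeft (del l) x := by
  rw [dz, contractLeft_ι_mul, del_dz]
  split_ifs <;> simp

/-- `∂_l ⌟ (dz̄_k * x) = − dz̄_k * (∂_l ⌟ x)`. -/
theorem contract_dzb_mul (l k : Fin n) (x : Forms K n) :
    contractLeft (del l) (dzb k * x) = - (dzb k * contractLeft (del l) x) := by
  rw [dzb, contractLeft_ι_mul, del_dzb, zero_smul, zero_sub]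

/-- `∂_l ⌟ dz̄_k = 0`. -/
theorem contract_dzb (l k : Fin n) : contractLeft (del l) (dzb k : Forms K n) = 0 := by
  rw [dzb, contractLeft_ι, del_dzb, map_zero]

/-- **Graded Leibniz through the even element `b`**: `∂_l ⌟ (b * x) = dz̄_l * x + b * (∂_l ⌟ x)`. -/
theorem contract_bForm_mul (l : Fin n) (x : Forms K n) :
    contractLeft (del l) (bForm * x) = dzb l * x + bForm * contractLeft (del l) x := by
  rw [bForm, Finset.sum_mul, map_sum, Finset.sum_mul]
  have h : ∀ k, contractLeft (del l) (dz k * dzb k * x)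
      = (if l = k then dzb k * x else 0) + dz k * dzb k * contractLeft (del l) x := by
    intro k
    rw [mul_assoc, contract_dz_mul, contract_dzb_mul]
    split_ifs <;> simp [mul_assoc]
  simp_rw [h]
  rw [Finset.sum_add_distrib, Finset.sum_ite_eq, if_pos (Finset.mem_univ l)]

/-- Generators anticommute with generators, so the even element `dz_k * dz̄_k` commutes with every generator. -/
theorem dz_mul_dzb_mul_ι (k : Fin n) (w : OneForms K n) :
    dz k * dzb k * ExteriorAlgebra.ι K w = ExteriorAlgebra.ι K w * (dz k * dzb k) := by
  have h1 : dzb k * ExteriorAlgebra.ι K w = -(ExteriorAlgebra.ι K w * dzb k) :=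
    eq_neg_of_add_eq_zero_left (ExteriorAlgebra.ι_add_mul_swap _ _)
  have h2 : dz k * ExteriorAlgebra.ι K w = -(ExteriorAlgebra.ι K w * dz k) :=
    eq_neg_of_add_eq_zero_left (ExteriorAlgebra.ι_add_mul_swap _ _)
  rw [mul_assoc, h1, mul_neg, ← mul_assoc, h2, neg_mul, neg_neg, mul_assoc]

/-- `b` commutes with every generator. -/
theorem bForm_mul_ι (w : OneForms K n) : bForm * ExteriorAlgebra.ι K w = ExteriorAlgebra.ι K w * bForm := by
  rw [bForm, Finset.sum_mul, Finset.mul_sum]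
  exact Finset.sum_congr rfl fun k _ => dz_mul_dzb_mul_ι k w

/-- In particular `b * dz̄_l = dz̄_l * b`, and the same for powers of `b`. -/
theorem bForm_pow_mul_dzb (l : Fin n) (m : ℕ) : bForm ^ m * dzb l = (dzb l * bForm ^ m : Forms K n) := by
  induction m with
  | zero => simp
  | succ m ih => rw [pow_succ, mul_assoc, dzb, bForm_mul_ι, ← mul_assoc, ← dzb, ih, mul_assoc]

/-- **`∂_l ⌟ b^m = m • dz̄_l * b^(m−1)`**. -/
theorem contract_bForm_pow (l : Fin n) (m : ℕ) :
    contractLeft (del l) (bForm ^ m : Forms K n) = (m : K) • (dzb l * bForm ^ (m - 1)) := by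
  have hcomm : (bForm : Forms K n) * dzb l = dzb l * bForm := by
    have h := bForm_pow_mul_dzb (K := K) (n := n) l 1
    rwa [pow_one] at h
  induction m with
  | zero => simp [contractLeft_one]
  | succ m ih =>
    rw [pow_succ', contract_bForm_mul, ih, mul_smul_comm, ← mul_assoc, hcomm, mul_assoc]
    rcases m with _ | m
    · simp
    · simp only [Nat.add_sub_cancel]
      rw [← pow_succ']
      push_cast
      simp only [add_smul, one_smul]
      abel

/-- **(S2) core: the polarised direction `θ_ab + θ_ba` contracts every power of `b` to zero.** -/
theorem thetaOp_add_thetaOp_bForm_pow (a b : Fin n) (m : ℕ) :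
    thetaOp a b (bForm ^ m : Forms K n) + thetaOp b a (bForm ^ m) = 0 := by
  rw [thetaOp_apply, thetaOp_apply, contract_bForm_pow, contract_bForm_pow, mul_smul_comm, mul_smul_comm,
    ← smul_add, ← mul_assoc, ← mul_assoc, ← add_mul, dzb, dzb, ExteriorAlgebra.ι_add_mul_swap, zero_mul, smul_zero]

/-- **The polarised directions kill `K[b]`**: `(θ_ab + θ_ba) ⌟ P(b) = 0` for every polynomial `P` — in particular for
`ch(F) ∈ ℚ[b]` ((S2)): the algebraic half of the named hypothesis shape (H-NC) of file I. -/
theorem thetaOp_add_thetaOp_aeval_bForm (a b : Fin n) (P : Polynomial K) :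
    thetaOp a b (Polynomial.aeval (bForm : Forms K n) P) + thetaOp b a (Polynomial.aeval (bForm : Forms K n) P) = 0 := by
  rw [Polynomial.aeval_eq_sum_range, map_sum, map_sum, ← Finset.sum_add_distrib]
  refine Finset.sum_eq_zero fun m _ => ?_
  rw [map_smul, map_smul, ← smul_add, thetaOp_add_thetaOp_bForm_pow, smul_zero]

/-! ## Part (b): the DICTIONARY LINE of files III / VI — `θ_q ⌟ [B_S]` in Mathlib's exterior algebra -/

/-- `P_s = dz_s ∧ dz̄_s`. -/
noncomputable def pairForm (s : Fin n) : Forms K n := dz s * dzb s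

/-- `P_s` commutes with every generator (it is even). -/
theorem pairForm_mul_ι (s : Fin n) (w : OneForms K n) :
    pairForm s * ExteriorAlgebra.ι K w = ExteriorAlgebra.ι K w * pairForm s :=
  dz_mul_dzb_mul_ι s w

/-- The `P_s` commute pairwise. -/
theorem pairForm_comm (s t : Fin n) : pairForm s * pairForm t = (pairForm t * pairForm s : Forms K n) := by
  have h1 : (dz t * dzb t * dz s : Forms K n) = dz s * (dz t * dzb t) := dz_mul_dzb_mul_ι t _
  have h2 : (dz t * dzb t * dzb s : Forms K n) = dzb s * (dz t * dzb t) := dz_mul_dzb_mul_ι t _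
  simp only [pairForm]
  conv_rhs => rw [← mul_assoc, h1, mul_assoc, h2, ← mul_assoc]

/-- `b_S = ∏_{s ∈ S} dz_s ∧ dz̄_s` (`∼ [B_S]`, the class of the coordinate sub-torus translate `B_S`; a commuting product
of even elements). -/
noncomputable def bS (S : Finset (Fin n)) : Forms K n :=
  S.noncommProd pairForm fun s _ t _ _ => pairForm_comm s t

/-- `b_∅ = 1`. -/
theorem bS_empty : bS (∅ : Finset (Fin n)) = (1 : Forms K n) := by
  simp [bS]

/-- `b_{S + a} = P_a * b_S` for `a ∉ S`. -/
theorem bS_insert {a : Fin n} {S : Finset (Fin n)} (ha : a ∉ S) :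
    bS (insert a S) = (pairForm a * bS S : Forms K n) := by
  rw [bS, bS, Finset.noncommProd_insert_of_notMem _ _ _ _ ha]

/-- `b_S` commutes with every generator. -/
theorem bS_mul_ι (S : Finset (Fin n)) (w : OneForms K n) :
    bS S * ExteriorAlgebra.ι K w = ExteriorAlgebra.ι K w * bS S := by
  induction S using Finset.induction_on with
  | empty => simp [bS_empty]
  | insert a S ha ih => rw [bS_insert ha, mul_assoc, ih, ← mul_assoc, pairForm_mul_ι, mul_assoc]

/-- `∂_l ⌟ (P_s * x) = δ_{ls} dz̄_s * x + P_s * (∂_l ⌟ x)`. -/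
theorem contract_pairForm_mul (l s : Fin n) (x : Forms K n) :
    contractLeft (del l) (pairForm s * x) = (if l = s then dzb s * x else 0) + pairForm s * contractLeft (del l) x := by
  rw [pairForm, mul_assoc, contract_dz_mul, contract_dzb_mul]
  split_ifs <;> simp [mul_assoc]

/-- **`∂_l ⌟ b_S = dz̄_l * b_{S ∖ l}` if `l ∈ S`, and `0` otherwise.** -/
theorem contract_bS (l : Fin n) (S : Finset (Fin n)) :
    contractLeft (del l) (bS S : Forms K n) = if l ∈ S then dzb l * bS (S.erase l) else 0 := by
  induction S using Finset.induction_on with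
  | empty => simp [bS_empty, contractLeft_one]
  | insert a S ha ih =>
    rw [bS_insert ha, contract_pairForm_mul, ih]
    by_cases hla : l = a
    · subst hla
      rw [if_pos rfl, if_neg ha, mul_zero, add_zero, if_pos (Finset.mem_insert_self l S), Finset.erase_insert ha]
    · rw [if_neg hla, zero_add]
      by_cases hlS : l ∈ S
      · rw [if_pos hlS, if_pos (Finset.mem_insert_of_mem hlS), Finset.erase_insert_of_ne (Ne.symm hla),
          bS_insert (fun h => ha (Finset.mem_of_mem_erase h)), ← mul_assoc, dzb, pairForm_mul_ι, mul_assoc]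
      · rw [if_neg hlS, mul_zero, if_neg]
        rw [Finset.mem_insert]
        exact fun h => h.elim hla hlS

/-- **`θ_{ik}(b_S) = dz̄_i * dz̄_k * b_{S ∖ k}` if `k ∈ S`, else `0`.** -/
theorem thetaOp_bS (i k : Fin n) (S : Finset (Fin n)) :
    thetaOp i k (bS S : Forms K n) = if k ∈ S then dzb i * dzb k * bS (S.erase k) else 0 := by
  rw [thetaOp_apply, contract_bS]
  split_ifs with h
  · rw [mul_assoc]
  · rw [mul_zero]

/-- `dz̄_s * P_s = 0` (`dz̄_s ∧ dz_s ∧ dz̄_s`). -/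
theorem dzb_mul_pairForm (s : Fin n) : dzb s * pairForm s = (0 : Forms K n) := by
  have h : (dzb s * dz s : Forms K n) = -(dz s * dzb s) :=
    eq_neg_of_add_eq_zero_left (ExteriorAlgebra.ι_add_mul_swap _ _)
  have h2 : (dzb s * dzb s : Forms K n) = 0 := ExteriorAlgebra.ι_sq_zero _
  rw [pairForm, ← mul_assoc, h, neg_mul, mul_assoc, h2, mul_zero, neg_zero]

/-- **`θ_{ik}(b_S) = 0` whenever `i ∈ S`** (`i = k`: `dz̄_k ∧ dz̄_k = 0`; `i ∈ S ∖ k`: the factor `P_i` of `b_{S∖k}`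
kills `dz̄_i`).  With `thetaOp_bS`: `θ_q ⌟ b_S` can be non-zero only for `q ∈ act S` of file VI. -/
theorem thetaOp_bS_eq_zero_of_mem {i k : Fin n} {S : Finset (Fin n)} (hi : i ∈ S) :
    thetaOp i k (bS S : Forms K n) = 0 := by
  rw [thetaOp_bS]
  split_ifs with hk
  · by_cases hik : i = k
    · subst hik
      rw [dzb, ExteriorAlgebra.ι_sq_zero, zero_mul]
    · have hi' : i ∈ S.erase k := Finset.mem_erase.2 ⟨hik, hi⟩
      have hc : (dzb k * pairForm i : Forms K n) = pairForm i * dzb k := (pairForm_mul_ι i _).symm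
      rw [← Finset.insert_erase hi', bS_insert (Finset.notMem_erase i _)]
      calc (dzb i * dzb k * (pairForm i * bS ((S.erase k).erase i)) : Forms K n)
          = (dzb i * pairForm i) * (dzb k * bS ((S.erase k).erase i)) := by
            rw [mul_assoc, ← mul_assoc (dzb k), hc]; simp only [mul_assoc]
        _ = 0 := by rw [dzb_mul_pairForm, zero_mul]
  · rfl

/-- The non-vanishing pattern, file VI's way round: if `θ_{ik}(b_S) ≠ 0` then `(i, k) ∈ act S` (`i ∉ S ∋ k`). -/
theorem mem_act_of_thetaOp_bS_ne_zero {i k : Fin n} {S : Finset (Fin n)} (h : thetaOp i k (bS S : Forms K n) ≠ 0) :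
    i ∉ S ∧ k ∈ S := by
  constructor
  · intro hi; exact h (thetaOp_bS_eq_zero_of_mem hi)
  · by_contra hk; apply h; rw [thetaOp_bS, if_neg hk]

end Summit.Ventures.HSemireg.ObstructionLocus
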